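import Summits.QuantumAdvantage.AdviceFreeQNC0.TwistBoundX3Proof
import Mathlib.Analysis.Complex.Trigonometric
import HarnessLib

/-!
# Cell qa-qnc0 — the bond twist for an ODD modulus: **`twistBoundXOdd : TwistBoundXOdd`**
(planner qa-qnc0-p1 g20, `exp20/Sketch20x.lean` §5, statement VERBATIM; ROUND-19 §4 "odd-twist principle")

For `m` odd, a FIXED bell set `B` and `γ ∈ (ZMod m)^N`, the correlation of the win indicator of `tGuess ⊕ 1_B` on the odd
class with the x-linear phase `e_m(Σ_{i : x_i} γ_i)` is `≤ 9·cos(π/(2m))^{#supp γ}·2^N`.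

Same 6-state bond-twisted path sum as `twistBoundX3` (`BondPathSum.lean`); the only new input is the per-site step for a
general unimodular phase `ω` (`btvNorm_succ_le_re`: factor `2 + |ω + ω̄|` instead of `4`, from
`‖ωP + Q‖² + ‖P + ωQ‖² = 2(‖P‖² + ‖Q‖²) + 2 Re((ω + ω̄) P Q̄)`) and the trigonometric fact that an `m`-th root of unity
`ω ≠ 1`, `m` odd, has `|Re ω| ≤ cos(π/m)` (`abs_cos_two_pi_mul_div_le`), i.e. `2 + |ω+ω̄| ≤ 4cos²(π/(2m))`.
Also typed VERBATIM: `RingOddModuliFormsSharp3` (the rung; assembly in `RingOddModuliForms.lean`).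
This file: statements, site phases, the per-site step and the trigonometry; the theorem is in `BondTwistOdd.lean`.

WHAT THIS IS NOT: even `m` is resonant (`ω = −1`) and excluded; crux 22907 untouched; separation NOT moved.
-/

noncomputable section

namespace Summit.QuantumAdvantage.AdviceFreeQNC0

open Finset Literature.Computability.QuantumComplexity Literature.Computability.QuantumComplexity.RingHLF
open Literature.Computability.MetaComplexity

namespace BondTwist3

open TransferWalk ConstBells TwistedTransfer Real

/-! ## Statements (Sketch20x §5, verbatim) -/

/-- **`TwistBoundXOdd`** (generalises `TwistBoundX3`): a bond twist by a character of `ZMod m`, `m` ODD, contracts the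
6-state transfer operator by `cos(π/(2m))` at every read site. -/
def TwistBoundXOdd : Prop :=
  open scoped Classical in
  ∃ A : ℝ, ∀ (m : ℕ) [NeZero m], Odd m → ∀ (N : ℕ) (B : Finset (Fin N)) (γ : Fin N → ZMod m),
    ‖∑ x : Fin N → Bool,
        (ZMod.stdAddChar (∑ i : Fin N, if x i then γ i else 0) : ℂ) *
          (if (OddZeros x ∧ RingHLF.Rel x (fun k => xor (tGuess x k) (decide (k ∈ B)))) then (1 : ℂ) else 0)‖
      ≤ A * (Real.cos (Real.pi / (2 * m))) ^ (univ.filter fun i : Fin N => γ i ≠ 0).card * (2 : ℝ) ^ N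

/-- **CONJECTURE / rung candidate `RingOddModuliFormsSharp3`**: bells = arbitrary per-cut tables of `K ≤ (log₂ N)^C` linear
forms of the INPUT bits modulo an ODD `m` win on `≤ (2/3 + ε)·2^{N−1}` odd inputs. -/
def RingOddModuliFormsSharp3 : Prop :=
  open scoped Classical in
  ∀ (m : ℕ) [NeZero m], Odd m → ∀ ε : ℝ, 0 < ε → ∀ C : ℕ, ∃ n₀ : ℕ, ∀ N ≥ n₀, ∀ K ≤ Nat.log 2 N ^ C,
    ∀ (lam : Fin K → Fin N → ZMod m) (tab : Fin N → (Fin K → ZMod m) → Bool),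
      ((univ.filter fun x : Fin N → Bool =>
          OddZeros x ∧ RingHLF.Rel x (fun k => xor (tGuess x k)
            (tab k (fun j => ∑ i : Fin N, if x i then lam j i else 0)))).card : ℝ)
        ≤ (2 / 3 + ε) * (2 : ℝ) ^ (N - 1)

/-! ## Site phases for a general modulus -/

variable {m : ℕ} [NeZero m] {n : ℕ}

/-- Site phases `e_m(γ_i)` (and `1` beyond the input length). -/
def phaseM (γ : Fin n → ZMod m) (i : ℕ) : ℂ := if h : i < n then (ZMod.stdAddChar (γ ⟨i, h⟩) : ℂ) else 1

/-- Per-site contraction factors. -/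
def siteRhoM (γ : Fin n → ZMod m) (ρ : ℝ) (i : ℕ) : ℝ := if h : i < n then (if γ ⟨i, h⟩ = 0 then 1 else ρ) else 1

omit [NeZero m] in
/-- `Π_{i<n} siteRhoM² = (ρ²)^{#supp γ}`. -/
theorem prod_siteRhoM_sq (γ : Fin n → ZMod m) (ρ : ℝ) :
    (∏ i ∈ range n, siteRhoM γ ρ i ^ 2) = (ρ ^ 2) ^ (univ.filter fun i : Fin n => γ i ≠ 0).card := by
  classical
  rw [← Fin.prod_univ_eq_prod_range (fun i => siteRhoM γ ρ i ^ 2) n]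
  have h : ∀ i : Fin n, siteRhoM γ ρ i.val ^ 2 = if γ i ≠ 0 then ρ ^ 2 else 1 := by
    intro i
    unfold siteRhoM
    rw [dif_pos i.isLt]
    by_cases hb : γ i = 0
    · rw [if_pos hb, if_neg (not_not.2 hb), one_pow]
    · rw [if_neg hb, if_pos hb]
  rw [Finset.prod_congr rfl (fun i _ => h i), Finset.prod_ite, Finset.prod_const, Finset.prod_const_one, mul_one]

/-- `m`-th roots of unity from the standard character are unimodular. -/
theorem norm_stdAddChar (j : ZMod m) : ‖(ZMod.stdAddChar j : ℂ)‖ = 1 := by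
  rw [ZMod.stdAddChar_apply]; exact Circle.norm_coe _

/-- Site phases have norm `≤ 1`. -/
theorem norm_phaseM_le (γ : Fin n → ZMod m) (i : ℕ) : ‖phaseM γ i‖ ≤ 1 := by
  unfold phaseM; split_ifs
  · exact (norm_stdAddChar _).le
  · simp

/-- The x-linear phase is the product of the site phases. -/
theorem char_eq_prodM (γ : Fin n → ZMod m) (x : Fin n → Bool) :
    (ZMod.stdAddChar (∑ i : Fin n, if x i then γ i else 0) : ℂ) = ∏ i : Fin n, (if x i then phaseM γ i.val else 1) := by
  rw [Literature.Computability.MetaComplexity.TwoModuli.stdAddChar_sum_ite γ x]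
  refine Finset.prod_congr rfl fun i _ => ?_
  unfold phaseM
  by_cases hx : x i = true
  · rw [if_pos hx, if_pos hx, dif_pos i.isLt]
  · rw [if_neg hx, if_neg hx]

/-- The x-phase along the walk is the bond product (general modulus). -/
theorem bondProd_eq_charM (γ : Fin (n + 1) → ZMod m) (u : Fin n → Bool) :
    (∏ g ∈ range (n + 1), bondPh (phaseM γ) g (ext false u g) (ext false u (g + 1))) =
      (ZMod.stdAddChar (∑ i : Fin (n + 1), if xOfU u i then γ i else 0) : ℂ) := by
  rw [char_eq_prodM γ (xOfU u), ← Fin.prod_univ_eq_prod_range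
    (fun g => bondPh (phaseM γ) g (ext false u g) (ext false u (g + 1))) (n + 1)]
  refine Finset.prod_congr rfl fun j _ => ?_
  rw [ext_false_succ, ext_false_eq]
  unfold bondPh xOfU
  generalize uExt u j.val = b
  generalize (if j.val = 0 then false else uExt u (j.val - 1)) = c
  cases b <;> cases c <;> rfl

/-! ## The per-site step for a general unimodular phase -/

/-- **Pair inequality**: `‖ωP + Q‖² + ‖P + ωQ‖² ≤ (2 + ‖ω + ω̄‖)(‖P‖² + ‖Q‖²)` for `‖ω‖ = 1`. -/
theorem pair_le (ω P Q : ℂ) (hω : ‖ω‖ = 1) :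
    ‖ω * P + Q‖ ^ 2 + ‖P + ω * Q‖ ^ 2 ≤ (2 + ‖ω + (starRingEnd ℂ) ω‖) * (‖P‖ ^ 2 + ‖Q‖ ^ 2) := by
  have hn : Complex.normSq ω = 1 := by rw [Complex.normSq_eq_norm_sq, hω, one_pow]
  rw [Complex.sq_norm, Complex.sq_norm, Complex.sq_norm, Complex.sq_norm, Complex.normSq_add, Complex.normSq_add,
    Complex.normSq_mul, Complex.normSq_mul, hn, one_mul, one_mul]
  have hcross : (ω * P * (starRingEnd ℂ) Q).re + (P * (starRingEnd ℂ) (ω * Q)).re =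
      ((ω + (starRingEnd ℂ) ω) * (P * (starRingEnd ℂ) Q)).re := by
    rw [map_mul, ← Complex.add_re]; congr 1; ring
  have hre : ((ω + (starRingEnd ℂ) ω) * (P * (starRingEnd ℂ) Q)).re ≤ ‖ω + (starRingEnd ℂ) ω‖ * (‖P‖ * ‖Q‖) := by
    refine (Complex.re_le_norm _).trans ?_
    rw [norm_mul, norm_mul, Complex.norm_conj]
  have h2 : 2 * (‖P‖ * ‖Q‖) ≤ ‖P‖ ^ 2 + ‖Q‖ ^ 2 := by nlinarith [sq_nonneg (‖P‖ - ‖Q‖)]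
  have hw : 0 ≤ ‖ω + (starRingEnd ℂ) ω‖ := norm_nonneg _
  rw [Complex.normSq_eq_norm_sq P, Complex.normSq_eq_norm_sq Q] at *
  nlinarith [mul_le_mul_of_nonneg_left h2 hw]

/-- **General step**: at a site with unimodular phase `ω = Φ a`, `btvNorm (k+1) a ≤ (2 + ‖ω + ω̄‖)·btvNorm k (a+1)`. -/
theorem btvNorm_succ_le_re (Φ : ℕ → ℂ) (f : ℕ → ZMod 3 → ℝ) (hf : ∀ j s, f j s ^ 2 ≤ 1) (k a : ℕ)
    (hΦ : ‖Φ a‖ = 1) :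
    btvNorm Φ f (k + 1) a ≤ (2 + ‖Φ a + (starRingEnd ℂ) (Φ a)‖) * btvNorm Φ f k (a + 1) := by
  unfold btvNorm cnsq6
  have hfa : ∀ E : ZMod 3, ‖(f a E : ℂ)‖ ^ 2 ≤ 1 := by
    intro E; rw [Complex.norm_real, Real.norm_eq_abs, sq_abs]; exact hf a E
  set c := 2 + ‖Φ a + (starRingEnd ℂ) (Φ a)‖ with hc
  have hc0 : 0 ≤ c := by positivity
  have hpt : ∀ E : ZMod 3, ‖BTV Φ f (k + 1) a E true‖ ^ 2 + ‖BTV Φ f (k + 1) a E false‖ ^ 2 ≤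
      c * (‖BTV Φ f k (a + 1) (E + 1) false‖ ^ 2 + ‖BTV Φ f k (a + 1) (E + 2) true‖ ^ 2) := by
    intro E
    rw [BTV_succ, BTV_succ]
    set P := BTV Φ f k (a + 1) (E + 1) false
    set Q := BTV Φ f k (a + 1) (E + 2) true
    have hcore := pair_le (Φ a) P Q hΦ
    simp only [bondPh, if_true, Bool.false_eq_true, if_false, one_mul, Bool.true_eq_false]
    rw [norm_mul, norm_mul, mul_pow, mul_pow]
    have h1 := hfa E
    have hA : 0 ≤ ‖P + Φ a * Q‖ ^ 2 := by positivity
    have hB : 0 ≤ ‖Φ a * P + Q‖ ^ 2 := by positivity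
    have hPQ : 0 ≤ ‖P‖ ^ 2 + ‖Q‖ ^ 2 := by positivity
    nlinarith [mul_nonneg hc0 hPQ]
  calc ∑ E : ZMod 3, (‖BTV Φ f (k + 1) a E true‖ ^ 2 + ‖BTV Φ f (k + 1) a E false‖ ^ 2)
      ≤ ∑ E : ZMod 3, c * (‖BTV Φ f k (a + 1) (E + 1) false‖ ^ 2 + ‖BTV Φ f k (a + 1) (E + 2) true‖ ^ 2) :=
        sum_le_sum fun E _ => hpt E
    _ = c * ((∑ E : ZMod 3, ‖BTV Φ f k (a + 1) (E + 1) false‖ ^ 2) +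
          ∑ E : ZMod 3, ‖BTV Φ f k (a + 1) (E + 2) true‖ ^ 2) := by rw [← sum_add_distrib, mul_sum]
    _ = c * ∑ E : ZMod 3, (‖BTV Φ f k (a + 1) E true‖ ^ 2 + ‖BTV Φ f k (a + 1) E false‖ ^ 2) := by
        rw [sum_shift 1 (fun E => ‖BTV Φ f k (a + 1) E false‖ ^ 2),
          sum_shift 2 (fun E => ‖BTV Φ f k (a + 1) E true‖ ^ 2), sum_add_distrib, add_comm]

/-! ## Odd roots of unity stay away from `−1` -/

/-- For `m` odd and `0 < k < m`: `|cos(2πk/m)| ≤ cos(π/m)`. -/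
theorem abs_cos_two_pi_mul_div_le {m k : ℕ} (hm : Odd m) (hk0 : 0 < k) (hkm : k < m) :
    |Real.cos (2 * π * k / m)| ≤ Real.cos (π / m) := by
  have hm0 : (0 : ℝ) < m := by exact_mod_cast (show 0 < m by omega)
  -- the half with `2k < m`
  have half : ∀ k : ℕ, 0 < k → 2 * k < m → |Real.cos (2 * π * k / m)| ≤ Real.cos (π / m) := by
    intro k hk0 h2k
    have hk1 : (1 : ℝ) ≤ k := by exact_mod_cast hk0
    have h2k1 : (2 * k + 1 : ℝ) ≤ m := by exact_mod_cast (show 2 * k + 1 ≤ m by omega)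
    have hθ0 : 0 ≤ 2 * π * k / m := by positivity
    have hlo : π / m ≤ 2 * π * k / m := by
      rw [div_le_div_iff_of_pos_right hm0]; nlinarith [Real.pi_pos]
    have hhi : 2 * π * k / m ≤ π - π / m := by
      have e : π - π / m - 2 * π * k / m = π * ((m : ℝ) - (2 * k + 1)) / m := by field_simp; ring
      have : 0 ≤ π * ((m : ℝ) - (2 * k + 1)) / m := div_nonneg (mul_nonneg Real.pi_pos.le (by linarith)) hm0.le
      linarith
    have hπm : π - π / m ≤ π := by linarith [show (0 : ℝ) ≤ π / m by positivity]
    rw [abs_le]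
    constructor
    · rw [← Real.cos_pi_sub]
      exact Real.cos_le_cos_of_nonneg_of_le_pi hθ0 hπm hhi
    · exact Real.cos_le_cos_of_nonneg_of_le_pi (by positivity) (hhi.trans hπm) hlo
  by_cases h2k : 2 * k < m
  · exact half k hk0 h2k
  · obtain ⟨r, hr⟩ := hm
    have h1 : 0 < m - k := by omega
    have h2 : 2 * (m - k) < m := by omega
    have e : 2 * π * k / m = 2 * π - 2 * π * ((m - k : ℕ) : ℝ) / m := by
      rw [Nat.cast_sub hkm.le]; field_simp; ring
    rw [e, Real.cos_two_pi_sub]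
    exact half (m - k) h1 h2

/-- `‖ω + ω̄‖ ≤ 2cos(π/m)` for `ω = e_m(j)`, `j ≠ 0`, `m` odd. -/
theorem norm_stdAddChar_add_conj_le (hm : Odd m) {j : ZMod m} (hj : j ≠ 0) :
    ‖(ZMod.stdAddChar j : ℂ) + (starRingEnd ℂ) (ZMod.stdAddChar j : ℂ)‖ ≤ 2 * Real.cos (π / m) := by
  rw [Complex.add_conj, Complex.norm_real, Real.norm_eq_abs, abs_mul, abs_of_pos two_pos]
  have hre : (ZMod.stdAddChar j : ℂ).re = Real.cos (2 * π * j.val / m) := by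
    rw [ZMod.stdAddChar_apply, ZMod.toCircle_apply]
    have : (2 * (π : ℂ) * Complex.I * (j.val : ℂ) / (m : ℂ)) = ((2 * π * (j.val : ℝ) / (m : ℝ) : ℝ) : ℂ) * Complex.I := by
      push_cast; ring
    rw [this, Complex.exp_ofReal_mul_I_re]
  rw [hre]
  have hk0 : 0 < j.val := Nat.pos_of_ne_zero fun h => hj ((ZMod.val_eq_zero j).1 h)
  linarith [abs_cos_two_pi_mul_div_le hm hk0 (ZMod.val_lt j)]

/-- The per-site factor: `2 + ‖ω + ω̄‖ ≤ 4cos²(π/(2m))`. -/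
theorem two_add_norm_le (hm : Odd m) {j : ZMod m} (hj : j ≠ 0) :
    2 + ‖(ZMod.stdAddChar j : ℂ) + (starRingEnd ℂ) (ZMod.stdAddChar j : ℂ)‖ ≤ 4 * Real.cos (π / (2 * m)) ^ 2 := by
  have h := norm_stdAddChar_add_conj_le hm hj
  have hsq : Real.cos (π / (2 * m)) ^ 2 = 1 / 2 + Real.cos (π / m) / 2 := by
    rw [Real.cos_sq]; congr 2; field_simp
  rw [hsq]; linarith

end BondTwist3

end Summit.QuantumAdvantage.AdviceFreeQNC0

end
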